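import Literature.MathematicalPhysics.QuantumLattice.FermiRG.BGM2006Sec3Flow
import HarnessLib

/-!
# BGM 2006 §2.8 (end) – §2.9: the sector-sum gains with fixed external sectors (Lemmas 2.4, 2.5), the
# two-point Schwinger function, and Theorem 1.1 versus the tree's named fact — statements, typed

G. Benfatto, A. Giuliani, V. Mastropietro, *Fermi liquid behavior in the 2D Hubbard model at low
temperatures*, Ann. Henri Poincaré **7** (2006) 809–898 = arXiv:cond-mat/0507686
[cite: BenfattoGiulianiMastropietro2006, §2.8-2.9]. Typer wave gate-hubbard-kl (D-0069 (2)), seat t2, file F2a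
of HOME/DAG.tsv: rows BGM06.L2.4 (FACT-LIST F-007), BGM06.L2.5 (F-008), BGM06.S2.9 (DEF, cite-only),
BGM06.T1.1 (FACT* = the EXISTING named fact `bgm_two_point_limit`, cite-only), aids BGM06.R1.4, BGM06.E1.10.
LOCATORS `pNNNN:Ln` = chunk:line of the `lit read` render of the arXiv TeX; numbers are the TeX labels.
Typing level as in `BGM2006Sec3Flow.lean` (imported: `LabelledTree`, `scalingDim` (2.78), `ScaleData`,
`Hyp236`, `Bound365`, `SmallC0`): predicates with explicit constants on labelled-tree profiles and
scale-indexed data; nothing asserted.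

## Locator note for the DAG (rows S2.9 / S4)

In the TeX render the displays (2.91)–(2.96) are the END OF §2.8 (the inductive proof of the sector-sum bound
(2.83), p0016:L113–p0017:L86), (2.97)/(2.98) are Lemmas 2.4/2.5 (p0017:L88–130, still §2.8), and §2.9 "The two
point Schwinger function" (p0017:L132) carries the displays labelled `\Eq(4.1)`–`\Eq(4.16)` (p0017:L140 –
p0019:L45) — the same text the DAG lists as row BGM06.S4 "sect. 4", outside the wave scope (W-002). So §2.9 is
recorded below as a CROSS-REFERENCE section (its objects exist in the tree), without typing (4.1)–(4.16).

## §2.9 — the two-point Schwinger function (row BGM06.S2.9; cite-only)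

The generating functional `𝒲(φ) = log ∫P(dψ) e^{−𝒱(ψ)+∫dx[φ⁺ψ⁻+ψ⁺φ⁻]}` (4.1) and
`S(x−y) = ∂²𝒲/∂φ⁺_{x,σ}∂φ⁻_{y,σ}|_{φ=0}` (4.2) (p0017:L138–p0018:L1); the multiscale integration with external
fields (4.3)–(4.10a) (`B^{(h)}`, `Q^{(h)}` with (4.8) `Q̂^{(h)} = Q̂^{(h+1)} − n̂_h Ĝ^{(h+1)}`, `G^{(h+1)} = Σ_{k≥h+1} g^{(k)}*Q^{(k)}`
(4.7), bounds (4.8a) `|Q̂^{(h)}−1| ≤ C|U||h|γ^h`, (4.8b)); the result (4.12) `Ŝ(k) = (1 + W(k))/D_{h_k}(k)`,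
`D_h(k) = −ik₀ + E_{h−1}(k) − μ`, `h_k = min{h : ĝ^{(h)}(k) ≠ 0}`, with (4.14) `|W(k)| ≤ C|U||h|γ^h`,
`|∂ⁿW| ≤ Cₙ|U||h|γ^{(1−n)h}` and the self-energy (4.15)–(4.16) `|Σ| ≤ C|U|`, `|∂Σ| ≤ C|U|²`, `|∂²Σ| ≤ Cc₀` — "the proof
of Theorem (1.1) under the assumption (2.36) and the assumption that (2.71a) is true for any `h_i − 1 ≥ h_β` is
complete" (p0019:L40–45). TREE OBJECTS (cited, not redefined): the finite-volume imaginary-time two-point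
function `S^{β,L}(𝐱,σ,−;𝐲,σ',+)` of (1.2)–(1.3)/(2.8) is
`Literature.MathematicalPhysics.QuantumLattice.hubbardSchwingerTwoPoint` (module `HubbardSchwingerFunction`:
KMS antiperiodicity, the free propagator (1.4), equal-time reduction to `hubbardThermalTwoPoint`);
the equal-time function is `hubbardThermalTwoPoint` (module `HubbardFermiLiquid`). Not in the tree: `Ŝ(k)` on
`𝒟_{β,L}`, `Σ(k)`, and (4.12)–(4.16) (watch-listed W-002; a GAP row if K1/K3 consumes them).

## Theorem 1.1 (row BGM06.T1.1, FACT*) versus `bgm_two_point_limit` — hypothesis map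

Print (p0003:L80–p0004:L1): 2D Hubbard model (hopping `½`, dispersion `2 − cos k₁ − cos k₂`), `0 < μ < μ₀ = (2−√2)/2`,
`β⁻¹ ≥ e^{−a/|U|}` (`a > 0` suitable), `∃ U₀ > 0`: `|U| ≤ U₀` ⟹ in the limit `L = ∞`, `Ŝ(k)` has the form (1.10)
`Z(θ)⁻¹[−ik₀ + v_F(θ)·(k⃗ − p_F(θ)) + R(k)]⁻¹` with `Z, v_F, p_F` real, (1.11) `Z = 1 + a(θ)U² + O(U³)`,
`v_F = v_F⁽⁰⁾ + b U + O(U²)`, `p_F = p_F⁽⁰⁾ + c U + O(U²)` (`a, |b|, |c|` bounded above and below), (1.12)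
`|R(k)| ≤ C[|k⃗ − p_F(θ)|² + k₀² + |k⃗ − p_F||k₀|]`… (p0004:L1). Tree fact
`Literature.MathematicalPhysics.QuantumLattice.bgm_two_point_limit` (module `HubbardFermiLiquid`): binders
`∀ μ ∈ (−4, −2−√2)` [= `0 < μ_BGM < (2−√2)/2` under `μ = 2μ_BGM − 4`, hopping `1`: MATCH],
`∃ U₀ c > 0, ∀ U ≠ 0, |U| ≤ U₀` [MATCH; the exclusion `U ≠ 0` is harmless], `∀ β, 0 < β ≤ exp(c/|U|)`
[= `β⁻¹ ≥ e^{−c/|U|}`: MATCH, `β_tree = β_BGM/2` absorbed in `c`], conclusion: the EQUAL-TIME finite-volume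
two-point functions converge as `L → ∞` [WEAKER than (1.10)–(1.12): the Fermi-liquid form, the reality of
`Z, v_F, p_F` (which ARE functions of the temperature, "slowly depending" on it for `β⁻¹ ≥ e^{−a/|U|}`, p0004:L4–12
and Remark (1.4)), the bounds (1.11) and the bound (1.12) on `R` are prose-only there — a documented weakening,
not a hypothesis mismatch; GAP row only if a consumer needs the printed form]. Constants depend on `μ` in the tree
fact; the print is silent ("not uniform in the chemical potential", Remark (1.4) 2)). No re-declaration here.

**Remarks (1.4)** (p0004:L51–p0005:L47; aid row BGM06.R1.4), docstring only: 1) `a` depends only on the second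
order; 2) not uniform in `μ`, expected technical, crossover to the half-filled non-Fermi liquid [R, AMR];
3) the Fermi surface at `T > 0` is the choice (1.7), regular and convex uniformly in `β`; 4) the resummed
expansion in the effective couplings with temperature-INDEPENDENT `U₀` ("specific of `d = 2` far from
half-filling"); 5) comparison with [DR] (jellium); 6) [BGM03] fixed the surface by a counterterm, whose
inversion "is essentially solved below" by dynamically changing the surface; [FST], [Sa2], [PS];
7) breakdown expected at lower temperatures (superconducting instabilities, also for repulsive `U` by the
Kohn–Luttinger mechanism) — prose, NOT a Literature fact (FACT-LIST §E).

## Note on the vertex products of (2.77)/(2.98) versus (3.6)/(3.69) (no print discrepancy)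

The products of (2.77)/(2.98) run over ALL non-endpoint vertices, `Π_{v not e.p.} (1/s_v!) γ^{δ(|P_v|)}`, where by
§2.6 item 2) (p0012:L75–82) the vertices of `τ` include the TRIVIAL vertices — one on every vertical scale line
the tree crosses — so consecutive vertices sit on consecutive scales and the factor `γ^{δ(|P_v|)}` is collected
once per scale; the products of (3.6)/(3.69) run over the `c`-vertices `V_c` only and therefore carry the scale
difference `(h_v − h_{v'})` to the preceding `c`-vertex explicitly. Same content, two bookkeepings (t1's
`GNTree.bgm_powerCounting` in `BGM2006Sec2Expansion` PROVES the telescoping for (2.77)); `prod277` below is the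
(2.77)/(2.98) form, `BGM2006Sec3.prodVc5`/`prodVc` the (3.6)/(3.69) form. (An earlier reading of this seat
flagged a "missing factor" — withdrawn.)
-/

noncomputable section

open Finset

namespace Literature.MathematicalPhysics.QuantumLattice.FermiRG

namespace BGM2006Sec2TwoPoint

open BGM2006Sec3

/-! ### §2.8 (end): Lemma 2.4 — the sector sum with `F = 3, 5` fixed external sectors (FACT-LIST F-007) -/

/-- **Lemma 2.4** (p0017:L88–99; FACT-LIST F-007, row BGM06.L2.4; proof App. A4). *"Given `h_β ≤ h ≤ 0` and a
tree `τ ∈ 𝒯_{h,n}` with all its labels, let us consider the sum `Σ_{Ω∖Ω_ext^{(F)}} Π_{v∈τ}(χ(Ω_v) Π_{l∈T_v} δ_{ω_l⁺,ω_l⁻})`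
(2.97) with `F` compatible with `P`, i.e. `F ≤ |P_{v₀}|`. If `F = 3`, (2.97) can be bounded by the r.h.s. of (2.83)
times `γ^{h/2}` and, if `F = 5`, (2.97) can be bounded by the r.h.s. of (2.83) times `γ^h`."* Typed on a family
`𝒯` of labelled trees (index `i` = the tree with all its labels and the choice of `Ω_ext^{(F)}`), the values
`S i F` of the sector sum (2.97) with `F` external sectors held fixed, and the values `rhs283 i` of the
right-hand side of (2.83) for that tree (`cⁿ γ^{−½h m₄(v₀)} Π_{v not e.p.} γ^{[−½m₄(v) + ½(|P_v|−3)𝟙(4≤|P_v|≤8) +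
½(|P_v|−1)𝟙(|P_v|≥10)]}`, p0016:L1–6 — typed in t1's §2.8 file; a parameter here; on t1's skeleton
carrier it is bridgeable to the (2.83) exponent `GNTree.sectorExp` of `BGM2006Sec2Expansion` through
`GNTree.profile` of `BGM2006Sec2Theorem21`). REGIME:
the index type `ι` ranges over the labelled trees of `𝒯_{h,n}` with `h_β ≤ h ≤ 0` (print's standing "Given
`h_β ≤ h ≤ 0`"); the two regime binders are not repeated here (this predicate carries no `ScaleData`; they are
explicit in `Lemma25`, whose instance family is the same).
[cite: BenfattoGiulianiMastropietro2006, Lemma 2.4 p0017:L88] -/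
def Lemma24 {ι : Type*} (γ : ℝ) (𝒯 : ι → LabelledTree) (rhs283 : ι → ℝ) (S : ι → ℕ → ℝ) : Prop :=
  ∀ i : ι,
    (3 ≤ (𝒯 i).rootLegs → S i 3 ≤ rhs283 i * γ ^ (((𝒯 i).h : ℝ) / 2)) ∧
      (5 ≤ (𝒯 i).rootLegs → S i 5 ≤ rhs283 i * γ ^ (𝒯 i).h)

/-! ### §2.8 (end): Lemma 2.5 — the bounds (2.98) on `J^{(3)}`, `J^{(5)}` (FACT-LIST F-008) -/

/-- **The external-sector exponents `e_F`** of the root factor `γ^{h(e_F − ¾|P_{v₀}|)}` in (2.77)/(2.98):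
`e_0 = 2`, `e_1 = 5/2` (Theorem 2.1 (2.77), p0015:L64–70), `e_3 = 3`, `e_5 = 7/2` (Lemma 2.5 (2.98), p0017:L112–120) —
`+½` from `F = 1` to `F = 3` (Lemma 2.4's gain `γ^{h/2}`) and `+½` again to `F = 5` (gain `γ^h` in total).
Only `F ∈ {0, 1, 3, 5}` occur in print; the
value `0` returned elsewhere is a junk value (documented). t1's `bgmExternalExp` covers `F ∈ {0,1}`.
[cite: BenfattoGiulianiMastropietro2006, §2.8 (2.77)/(2.98) p0017:L116] -/
def externalExp (F : ℕ) : ℝ :=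
  if F = 0 then 2 else if F = 1 then 5 / 2 else if F = 3 then 3 else if F = 5 then 7 / 2 else 0

/-- **The vertex product of (2.77)/(2.98)**: `Π_{v not e.p.} (1/s_v!) γ^{δ(|P_v|)}` (p0015:L64–70, p0017:L116–120),
`δ` = `scalingDim` (2.78), the product running over ALL non-endpoint vertices of `τ`, trivial ones included
(§2.6 item 2); see the module doc note) — instantiate `T.V` accordingly (t1's `GNTree.vertexWeight` is the same
product computed on the tree skeleton). [cite: BenfattoGiulianiMastropietro2006, §2.8 (2.77) p0015:L66] -/
def prod277 (γ : ℝ) (T : LabelledTree) : ℝ :=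
  ∏ v ∈ T.V, (1 / ((T.branches v).factorial : ℝ)) * γ ^ scalingDim (T.legs v)

/-- **Lemma 2.5** (p0017:L104–122; FACT-LIST F-008, row BGM06.L2.5; DECOMP U6). *"Given `h_β ≤ h ≤ 0`, `τ ∈ 𝒯_{h,n}`,
`P ∈ 𝒫_τ`, `T ∈ 𝐓`, if `E_k(k)` satisfies (2.36) for any `k ≥ h`, if `λ̃_{h_{v*}−1,Ω_{v*}}` satisfies (2.71a) for any
endpoint `v* ∈ τ` and if `U₀|h_β| = c₀` is small enough, then
`J^{(3)}_{h,n}(τ,P,T) ≤ (c|U|)ⁿ γ^{h(3 − ¾|P_{v₀}|)} Π_{v not e.p.} (1/s_v!) γ^{δ(|P_v|)}`,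
`J^{(5)}_{h,n}(τ,P,T) ≤ (c|U|)ⁿ γ^{h(7/2 − ¾|P_{v₀}|)} Π_{v not e.p.} (1/s_v!) γ^{δ(|P_v|)}` (2.98)."* — "a generalization of
Theorem 2.1" using Lemma 2.4's gains `γ^{h/2}`, `γ^h`. `J^{(F)}_{h,n}` is the sector-summed, constraint-weighted
`L¹` norm (2.76) of `W^{(mod)}_{τ,P,Ω,T}` with `F` external sectors not summed. Typed on the data `D` (for the
hypotheses (2.36) — at indices `h < k ≤ 0`, see the "Reading" note of `BGM2006Sec3Flow` — (2.71a) = `Bound365`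
at `h ≤ j ≤ 0`, and the `c₀` device `SmallC0`), a family `𝒯` of labelled trees of root scale `(𝒯 i).h` and
the values `J i F`. CARRIER CONVENTION (wave cross-reads of this file): unlike `Lemma24`, no
"`F` compatible with `P`" guard `F ≤ |P_{v₀}|` is carried — `J^{(F)}_{h,n}` (2.76) is defined only for
`0 < F ≤ |P_{v₀}|` ("`Ω_ext^{(F)} ⊂ Ω_{v₀}` … of cardinality `F`", p0015:L42–45) — so the instance sets
`J i F := 0` whenever `F > (𝒯 i).rootLegs`; on those components the two conjuncts read `0 ≤ r.h.s.`, true for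
`c ≥ 0`, `γ > 0`, and carry no content beyond print. (t1's `lemma25_iff_bound277` in `BGM2006Sec2Theorem21`
records this unguarded shape against the common `BGMBound277`; a guarded variant, if the referee prefers it,
changes both files together.) [cite: BenfattoGiulianiMastropietro2006, Lemma 2.5 p0017:L104] -/
def Lemma25 {ι : Type*} (D : ScaleData) (c : ℝ) (C : ℕ → ℝ) (Cl c₀ : ℝ) (𝒯 : ι → LabelledTree)
    (J : ι → ℕ → ℝ) : Prop :=
  SmallC0 D c₀ →
    ∀ i : ι, D.hβ ≤ (𝒯 i).h → (𝒯 i).h ≤ 0 →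
      (∀ k : ℤ, (𝒯 i).h < k → k ≤ 0 → Hyp236 D C k) →
        (∀ j : ℤ, (𝒯 i).h ≤ j → j ≤ 0 → Bound365 D Cl j) →
          J i 3 ≤ (c * |D.U|) ^ (𝒯 i).n *
              D.γ ^ (((𝒯 i).h : ℝ) * (3 - 3 / 4 * ((𝒯 i).rootLegs : ℝ))) * prod277 D.γ (𝒯 i) ∧
            J i 5 ≤ (c * |D.U|) ^ (𝒯 i).n *
              D.γ ^ (((𝒯 i).h : ℝ) * (7 / 2 - 3 / 4 * ((𝒯 i).rootLegs : ℝ))) * prod277 D.γ (𝒯 i)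

end BGM2006Sec2TwoPoint

end Literature.MathematicalPhysics.QuantumLattice.FermiRG
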